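import Summits.Ventures.PercRepro.GenQFlatGood

/-!
# PercRepro — THE RANK-`5` ROWS OF RECORD (generic-weak constants), as LP rows on the core (night-4, gen 7)

The three per-flat row templates of `GenQFlatRows` instantiated at `r = 5`, `t = 6` with the constants of
`GenQRankStepBounds` / `GenQFlatGood` — exactly the rows of the `SOLID5` block of the profile LP
(`mining/night-4/g7/kit97b/leanlp_q.py`): with `NR M G 5 s` the number of rank-`5` flats with `s` points of `G`,

* (S7q) `sum_flats_kappa5_le`: `Σ_s κ₅(s)·NR 5 s ≤ C(|G|, 5)`, `κ₅(s) = ⌊(2C(s,5) − 4C(s,4) − C(s,3))/2⌋`;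
* (R6b) `DFq_add_choose_ge_rho6`: `#{|G∖S| < 6} + #{|G∖S| = 6} + Σ_s ρ₆(s)·NR 5 s ≤ DF₆ + C(|G|, 6)`,
  `ρ₆(s) = ⌊(20C(s,6) − 50C(s,4) − 2C(s,3))/20⌋`;
* (R6a) `DFq_ge_c6`: `#{|G∖S| < 6} + Σ_s c₆(s)·NR 5 s ≤ DF₆`, `c₆(s) = ρ₆(s)` for `s ≥ 17`, `0` below,

on every rank-`q` set `G ⊆ gr M` (`q ≥ 6`) of a Core matroid with `f(4) ≤ 10` — together with (S1r≤) / (S5r) of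
`GenQFlatFacts` at `r = 5` the rank-`5` analogue of the `(8, 6)` rows (S6q) / (R5b) / (R5a).  The numbers (exact):
`κ₅(21) = 7714`, `ρ₆(21) = 39168`, `κ₅(s) = 0` for `s ≤ 14`, `ρ₆(s) = 0` for `s ≤ 13`.  Imports `GenQFlatGood`.
-/
namespace PercRepro.Night4

open Finset ThmH SixFour GenQ PerFlat Star NightThree

variable {α : Type} [DecidableEq α] {M : Matroid α} [M.Finite]

/-- `κ₅(s) = ⌊(2C(s,5) − 4C(s,4) − C(s,3))/2⌋` (natural subtraction). -/
def kappa5 (s : ℕ) : ℕ := (2 * s.choose 5 - (4 * s.choose 4 + s.choose 3)) / 2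

/-- `ρ₆(s) = ⌊(20C(s,6) − 50C(s,4) − 2C(s,3))/20⌋`. -/
def rho6 (s : ℕ) : ℕ := (20 * s.choose 6 - (50 * s.choose 4 + 2 * s.choose 3)) / 20

/-- `c₆(s) = ρ₆(s)` for `s ≥ 17`, `0` below. -/
def c6 (s : ℕ) : ℕ := if 17 ≤ s then rho6 s else 0

/-- `κ₅(21) = 7714`. -/
theorem kappa5_twentyone : kappa5 21 = 7714 := by decide

/-- `ρ₆(21) = 39168`. -/
theorem rho6_twentyone : rho6 21 = 39168 := by decide

/-- **`κ₅(|F ∩ G|) ≤ #{rank-5 5-subsets of F ∩ G}`** for a rank-`5` flat `F` on the core. -/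
theorem kappa5_le {p : ℕ} (hc : Core M p) (h10 : ∀ F ∈ flatsQ M 4, F.card ≤ 10) (G : Finset α) {F : Finset α}
    (hF : F ∈ flatsQ M 5) :
    kappa5 (F ∩ G).card ≤
      (((F ∩ G).powersetCard 5).filter (fun A : Finset α => M.eRk (A : Set α) = ((5 : ℕ) : ℕ∞))).card := by
  have h := two_mul_choose_five_le hc h10 hF (Finset.inter_subset_left (s₂ := G))
  unfold rkSets at h
  unfold kappa5
  omega

/-- **`ρ₆(|F ∩ G|) ≤ #{rank-5 6-subsets of F ∩ G}`** for a rank-`5` flat `F` on the core. -/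
theorem rho6_le {p : ℕ} (hc : Core M p) (h10 : ∀ F ∈ flatsQ M 4, F.card ≤ 10) (G : Finset α) {F : Finset α}
    (hF : F ∈ flatsQ M 5) :
    rho6 (F ∩ G).card ≤
      (((F ∩ G).powersetCard 6).filter (fun A : Finset α => M.eRk (A : Set α) = ((6 - 1 : ℕ) : ℕ∞))).card := by
  show rho6 (F ∩ G).card ≤
      (((F ∩ G).powersetCard 6).filter (fun A : Finset α => M.eRk (A : Set α) = ((5 : ℕ) : ℕ∞))).card
  have h := twenty_mul_choose_six_le hc h10 hF (Finset.inter_subset_left (s₂ := G))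
  unfold rkSets at h
  unfold rho6
  omega

/-- **`c₆(|F ∩ G|) ≤ #goodSets`** for a rank-`5` flat `F` on the core (`q ≥ 6`). -/
theorem c6_le_good {p : ℕ} (hc : Core M p) (h10 : ∀ F ∈ flatsQ M 4, F.card ≤ 10) {G : Finset α} {q : ℕ}
    (hG : G ⊆ gr M) (hrG : M.eRk (G : Set α) = (q : ℕ∞)) (hq : 6 ≤ q) {F : Finset α} (hF : F ∈ flatsQ M 5) :
    c6 (F ∩ G).card ≤ (goodSets M G F q 6 (6 - 1)).card := by
  show c6 (F ∩ G).card ≤ (goodSets M G F q 6 5).card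
  unfold c6
  split_ifs with h17
  · have h := twenty_mul_choose_six_le_good hc h10 hG hrG hq hF h17
    unfold rho6
    omega
  · exact Nat.zero_le _

/-- **(S7q) on the core**: `Σ_s κ₅(s)·NR 5 s ≤ C(|G|, 5)`. -/
theorem sum_flats_kappa5_le {p : ℕ} (hc : Core M p) (h10 : ∀ F ∈ flatsQ M 4, F.card ≤ 10) {G : Finset α}
    (hG : G ⊆ gr M) :
    ∑ s ∈ Finset.range (G.card + 1), kappa5 s * NR M G 5 s ≤ G.card.choose 5 :=
  sum_flats_kappa_le hG 5 kappa5 (fun _ hF => kappa5_le hc h10 G hF)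

/-- **(R6b) on the core**: `#{|G∖S| < 6} + #{|G∖S| = 6} + Σ_s ρ₆(s)·NR 5 s ≤ DF₆ + C(|G|, 6)`. -/
theorem DFq_add_choose_ge_rho6 {p : ℕ} (hc : Core M p) (h10 : ∀ F ∈ flatsQ M 4, F.card ≤ 10) {G : Finset α}
    (hG : G ⊆ gr M) (q : ℕ) :
    ((Rq M G q).filter (fun S : Finset α => (G \ S).card < 6)).card +
      ((Rq M G q).filter (fun S : Finset α => (G \ S).card = 6)).card +
      ∑ s ∈ Finset.range (G.card + 1), rho6 s * NR M G (6 - 1) s ≤ DFq M G q 6 + G.card.choose 6 :=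
  DFq_add_choose_ge_flat_rows hG q (by norm_num) rho6 (fun _ hF => rho6_le hc h10 G hF)

/-- **(R6a) on the core** (`q ≥ 6`): `#{|G∖S| < 6} + Σ_s c₆(s)·NR 5 s ≤ DF₆`. -/
theorem DFq_ge_c6 {p : ℕ} (hc : Core M p) (h10 : ∀ F ∈ flatsQ M 4, F.card ≤ 10) {G : Finset α} {q : ℕ}
    (hG : G ⊆ gr M) (hrG : M.eRk (G : Set α) = (q : ℕ∞)) (hq : 6 ≤ q) :
    ((Rq M G q).filter (fun S : Finset α => (G \ S).card < 6)).card +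
      ∑ s ∈ Finset.range (G.card + 1), c6 s * NR M G (6 - 1) s ≤ DFq M G q 6 :=
  DFq_ge_flat_good_rows G q (by norm_num) c6 (fun _ hF => c6_le_good hc h10 hG hrG hq hF)

end PercRepro.Night4
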